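import Summits.CriticalPhenomena.CardyFormulaZ2.Theorems.CardyBoundaryCoulombGasHalfPlaneMarkDensityLawNEPositivity
import Summits.CriticalPhenomena.CardyFormulaZ2.Theorems.CardyBoundaryCoulombGasHalfPlaneMarkDensityLawGapClosing
import Summits.CriticalPhenomena.CardyFormulaZ2.Theorems.CardyBoundaryCoulombGasHalfPlaneMarkDensityLawDensityRegularity
import Summits.CriticalPhenomena.CardyFormulaZ2.Theorems.CardyBoundaryCoulombGasHalfPlaneMarkDensityLawNonDegeneracy
import Summits.CriticalPhenomena.CardyFormulaZ2.Theorems.CardyBoundaryCoulombGasHalfPlaneMarkDensityLawJointLimitC1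

/-!
# `HalfPlaneMarkDensityLaw` (crux stmt-CriticalPhenomena-5661), line `Sketch`, lead c12-0:
# THE A-PRIORI STRUCTURE OF THE COLLINEAR HALF-PLANE CROSSING FUNCTION — one citation point

`P_n(a,b,c,y) = P_{1/2}[[⌊an⌋,⌊bn⌋]×{0} ↔ [⌊cn⌋,⌊yn⌋]×{0} in ℤ×ℕ]`, `lawSeq a b c x n = n·P[E_n]` the crux's sequence.
Everything below is unconditional (RSW-level input only; no conformal invariance, no arm separation) and is the
union of the a-priori programme of seats c2-0 … c12-0:

* `lawSeq_twoSided` — **the lattice mark density is `Θ(1)`:** `0 < c₁ ≤ n·P[E_n(a,b,c,x)] ≤ B` eventually;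
* `jointLimit_structure` — **along a subsequence of every subsequence, `P_n` converges on the whole chamber to a
  function `G` which is:** `(0,1)`-valued; `C¹` with `∂₁G < 0 < ∂₂G`, `∂₃G < 0 < ∂₄G` at EVERY chamber point (so
  strictly monotone in each mark); invariant under translations and under the reflection
  `(a,b,c,y) ↦ (−y,−c,−b,−a)`; and tends to `1` as the gap closes (`c ↓ b`).  (Decay to `0` for a short source or
  target arc: `Subseq.exists_jointLimit_source_decay` / `…target_decay`; wired self-duality: `SelfDual.selfDualReflection`.)

The crux (equivalently C⁺) is exactly the IDENTIFICATION `G = F∘η` (`halfPlaneMarkDensityLaw_iff_jointLimits`,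
c2-0) — what is missing is Möbius covariance and the profile, i.e. conformal invariance; see also
`Apriori.stub_fakeProfile` (the listed properties, even with Möbius covariance and self-duality, do not single
out `F`).
-/

noncomputable section

namespace Summit.CriticalPhenomena.CardyFormulaZ2.Cruxes.HalfPlaneMarkDensityLaw.SketchLine

open Literature.Probability.Percolation Literature.Probability.LatticeModels
open MeasureTheory Filter Set
open scoped Topology
open Summit.CriticalPhenomena.CardyFormulaZ2.Theorems.HalfPlaneMarkDensityLaw.Negative

namespace Apriori

/-- **The lattice mark density is `Θ(1)`**: for `a < b < c < x` there are `c₁ > 0` and `B` with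
`c₁ ≤ n · P_{1/2}[E_n(a,b,c,x)] ≤ B` for all large `n`. [folklore] -/
theorem lawSeq_twoSided :
    ∀ {a b c x : ℝ}, a < b → b < c → c < x →
      ∃ c₁ B : ℝ, 0 < c₁ ∧ ∀ᶠ n : ℕ in atTop, c₁ ≤ lawSeq a b c x n ∧ lawSeq a b c x n ≤ B := by
  intro a b c x hab hbc hcx
  obtain ⟨c₁, hc₁, hlo⟩ := TwoArmLower.stub_densityPositivity a b c x hab hbc hcx
  obtain ⟨B, hhi⟩ := Density.lawSeq_bounded hab hbc hcx
  exact ⟨c₁, B, hc₁, hlo.and hhi⟩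

/-- **The a-priori structure of the joint subsequential scaling limits of the half-plane four-arc crossing
probability of critical bond percolation on `ℤ²`.**  Every subsequence `φ` has a further subsequence `φ ∘ ψ`
along which `P_n(a,b,c,y)` converges at every chamber point `a < b < c < y` to `G(a,b,c,y)`, where `G` takes
values in `(0,1)`, has all four partial derivatives at every chamber point with
`∂₁G < 0 < ∂₂G`, `∂₃G < 0 < ∂₄G`, is invariant under translations and under the reflection of the marks, and
tends to `1` as the gap between the arcs closes. [folklore] -/
theorem jointLimit_structure :
    ∀ (φ : ℕ → ℕ), StrictMono φ → ∃ ψ : ℕ → ℕ, StrictMono ψ ∧ ∃ G : ℝ → ℝ → ℝ → ℝ → ℝ,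
      (∀ a b c y : ℝ, a < b → b < c → c < y →
        Tendsto (fun n ↦ μ.real (openCrossing halfPlane (arcA a b (φ (ψ n)))
          (rowIcc ⌊c * (φ (ψ n) : ℕ)⌋ ⌊y * (φ (ψ n) : ℕ)⌋))) atTop (𝓝 (G a b c y))) ∧
      (∀ a b c y : ℝ, a < b → b < c → c < y →
        (0 < G a b c y ∧ G a b c y < 1) ∧
        (deriv (fun s ↦ G s b c y) a < 0 ∧ 0 < deriv (fun s ↦ G a s c y) b ∧
          deriv (fun s ↦ G a b s y) c < 0 ∧ 0 < deriv (G a b c) y) ∧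
        (DifferentiableAt ℝ (fun s ↦ G s b c y) a ∧ DifferentiableAt ℝ (fun s ↦ G a s c y) b ∧
          DifferentiableAt ℝ (fun s ↦ G a b s y) c ∧ DifferentiableAt ℝ (fun s ↦ G a b c s) y) ∧
        (∀ t : ℝ, G (a + t) (b + t) (c + t) (y + t) = G a b c y) ∧
        G (-y) (-c) (-b) (-a) = G a b c y) ∧
      (∀ a b y : ℝ, a < b → b < y → Tendsto (fun c ↦ G a b c y) (𝓝[>] b) (𝓝 1)) := by
  intro φ hφ
  obtain ⟨ψ, hψ, G, hG⟩ := Subseq.exists_jointSubseqLimit φ hφ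
  have hθ : StrictMono (φ ∘ ψ) := hφ.comp hψ
  have hG' : ∀ a b c y : ℝ, a < b → b < c → c < y →
      Tendsto (fun n ↦ μ.real (openCrossing halfPlane (arcA a b ((φ ∘ ψ) n))
        (rowIcc ⌊c * ((φ ∘ ψ) n : ℕ)⌋ ⌊y * ((φ ∘ ψ) n : ℕ)⌋))) atTop (𝓝 (G a b c y)) := hG
  refine ⟨ψ, hψ, G, hG, fun a b c y hab hbc hcy ↦ ⟨⟨?_, ?_⟩, ?_, ?_, ?_, ?_⟩, fun a b y hab hby ↦ ?_⟩
  · exact Subseq.jointLimit_pos hG' hθ hab hbc hcy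
  · exact Window.stub_jointLimit_lt_one hG' hθ hab hbc hcy
  · exact NearEndPos.jointLimit_partials_sign hG' hθ hab hbc hcy
  · exact (NearEnd.jointLimit_C1 hG' hθ).1 a b c y hab hbc hcy
  · exact fun t ↦ Subseq.translate_of_jointLimit hG' hθ hab hbc hcy t
  · exact Subseq.reflect_of_jointLimit hG' hθ hab hbc hcy
  · exact GapClose.stub_jointLimit_tendsto_one hG' hθ hab hby

end Apriori

end Summit.CriticalPhenomena.CardyFormulaZ2.Cruxes.HalfPlaneMarkDensityLaw.SketchLine
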